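import Summits.BirchSwinnertonDyer.BirchSwinnertonDyer.Theorems.PrintCf2RamifiedOffTYZSquareSilenceTwoRPQ
import Summits.BirchSwinnertonDyer.BirchSwinnertonDyer.Theorems.PrintCf2RamifiedOffTYZSquareSilenceTwoRPQFive
import HarnessLib

/-!
# Crux `PrintCf2.RamifiedOffTYZOfFacts` (stmt-BirchSwinnertonDyer-20509), line `offtyz-v7`, LEAD cycle 13 (cruxlead-20509 g12):
# THE COMPLETE CELL `n = 2rpq`, `r ≡ 3 (mod 4)`, `p ≡ q ≡ 1 (mod 8)`, `(−r/p) = (−r/q) = 1` — NO condition on `(p/q)`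

THEOREMS ONLY (no `def`, no named fact, no `sorry`), `--supports stmt-BirchSwinnertonDyer-20509` (item 23431 = C⁺, even three-prime sectors).

p737143 (`…SquareSilenceTwoRPQ`) proved the lower half of C⁺ on this cell under `(p/q) = −1` with the PAIR witness `φ_pφ_q`.  When `(p/q) = +1` the SINGLE
Frobenius `φ_p` is already a top witness: its Euler symbols `(−1/p), (−2/p), (−r/p), (−q/p) = (q/p) = (p/q)` are all `+1`, so it is `L_n(i)`-trivial by the
toolkit of p737408 (`TwoRPQFive.trivialOnL_of_frobenius_display`), and `φ_p ∉ Gal(ℍ′_n/H_n)` is (F5).  The proper blocks are as before (`2r` free, `2rp`,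
`2rq` with the even coefficients `|𝓛(q)|`, `|𝓛(p)|`, none `≡ 5`).  Hence the condition `(p/q) = −1` of p737143 is dropped (and `p ≠ q` follows from
square-freeness): the whole residue type `(1, 1, r)` of three-prime even `n` with `(−r/p) = (−r/q) = 1` is one by-name cell.
* `two_dvd_scriptL_two_rpq_all_of_valuePrinted`, ★ **`two_dvd_scriptL_two_rpq_all_of_facts :
  (tyz_cmPointRingClassFrobeniusValueData ∧ thm11_parity_of_scriptL ∧ GZK) → ∀ n r p q, … → ∀ L, IsScriptL n L → 2 ∣ L`**.
Beyond-print theorem: YES (conditional on the three named facts).  BSD is not proved by any of this; no class is closed by this file.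

References: [cite: TianYuanZhang2017, Thm. 1.1, §1 (p0002 L101–L110), §3.1 (p0011 L1–L73), Prop. 3.2 (2), Thm. 3.5, Thm. 3.6 (2), Lemma 3.18, proof of
Lemma 3.21 (p0020 L27–L63)]; [cite: Cox2013, §5.C Lemma 5.19, (5.22), Thm. 5.23, Cor. 5.25, §9.A]; [cite: HeathBrown1994SelmerCongruentII, §1];
[cite: Darmon2004, Thm. 3.22].
-/

noncomputable section

open scoped Classical

open WeierstrassCurve WeierstrassCurve.Affine Finset Literature.NumberTheory.EllipticCurves
  Literature.NumberTheory.EllipticCurves.TianYuanZhang2017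
  Literature.NumberTheory.EllipticCurves.TianYuanZhang2017.W2
  Summit.BirchSwinnertonDyer.Rank1Residual.P2.GenusPeriodTransferLayer
  Summit.BirchSwinnertonDyer.Rank1Residual.P2
  Summit.BirchSwinnertonDyer.PrintCf2.MoverAssembly
  Summit.BirchSwinnertonDyer.PrintCf2.SquareSilenceEven
  Summit.BirchSwinnertonDyer.PrintCf2.SquareSilenceCoefficients
  Summit.BirchSwinnertonDyer.PrintCf2.LowerHalfTwoPrimesEvenDisplays
  Summit.BirchSwinnertonDyer.PrintCf2.SixPQ
  Summit.BirchSwinnertonDyer.PrintCf2.TwoRPQ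
  Summit.BirchSwinnertonDyer.PrintCf2.TwoRPQFive

set_option autoImplicit false

namespace Summit.BirchSwinnertonDyer.PrintCf2.TwoRPQAll

variable {n : ℕ}

/-- **THE LOWER HALF OF C⁺ ON THE WHOLE CELL `n = 2rpq`** (`r ≡ 3 (4)`, `p ≡ q ≡ 1 (8)`, `(−r/p) = (−r/q) = 1`, any `(p/q)`), display shape over
`D.Printed ∧ D.CMPointRingClassFrobeniusValuePrinted`: `(p/q) = −1` is p737143 (pair witness); `(p/q) = +1` is the single witness `φ_p` (all Euler symbols
`+1`, toolkit p737408) with the even coefficients on `2rp`, `2rq`.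
[cite: TianYuanZhang2017, Thm. 1.1, Thm. 3.5, Lemma 3.18, §3.1, Prop. 3.2 (2), Thm. 3.6 (2), proof of Lemma 3.21] [cite: Cox2013, §5.C Cor. 5.25, §9.A] [cite: Darmon2004, Thm. 3.22] -/
theorem two_dvd_scriptL_two_rpq_all_of_valuePrinted (hGZK : rank_eq_analyticRank_of_analyticRank_le_one) (h11 : thm11_parity_of_scriptL)
    (hsq : Squarefree n) {r p q : ℕ} (hr : r.Prime) (hp : p.Prime) (hq : q.Prime) (hn : n = 2 * r * p * q) (hr4 : r % 4 = 3)
    (hp8 : p % 8 = 1) (hq8 : q % 8 = 1) (hrp : jacobiSym (-(r : ℤ)) p = 1) (hrq : jacobiSym (-(r : ℤ)) q = 1)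
    (hra : haveI := isElliptic_congruentNumberCurve hsq.ne_zero; (congruentNumberCurve n).analyticRank = 1)
    (D : GenusPointData n) (hPr : D.Printed) (hV : D.CMPointRingClassFrobeniusValuePrinted)
    {x y : ℚ} (hxy : (congruentNumberCurve n).toAffine.Nonsingular x y)
    (hgen : haveI := isElliptic_congruentNumberCurve hsq.ne_zero;
      ∀ P, ∃ k : ℤ, IsOfFinAddOrder (P - k • (Point.some x y hxy : (congruentNumberCurve n).toAffine.Point)))
    (hx : ¬ ∃ r : ℚ, x = r ^ 2 ∨ x = -r ^ 2 ∨ x = n * r ^ 2 ∨ x = -(n * r ^ 2))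
    (hx2 : ¬ ∃ r : ℚ, x = 2 * r ^ 2 ∨ x = -(2 * r ^ 2) ∨ x = 2 * n * r ^ 2 ∨ x = -(2 * n * r ^ 2)) :
    ∀ L : ℤ, IsScriptL n L → (2 : ℤ) ∣ L := by
  have hn0 : n ≠ 0 := hsq.ne_zero
  have hnn : n ∈ n.divisors := Nat.mem_divisors_self n hn0
  have hp2 : p ≠ 2 := by omega
  have hq2 : q ≠ 2 := by omega
  have hpq : p ≠ q := by
    rintro rfl; exact hp.one_lt.ne' (Nat.isUnit_iff.mp (hsq p ⟨2 * r, by rw [hn]; ring⟩))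
  by_cases hleg : jacobiSym p q = -1
  · exact TwoRPQ.two_dvd_scriptL_two_rpq_of_valuePrinted hGZK h11 hsq hr hp hq hpq hn hr4 hp8 hq8 hrp hrq hleg hra D hPr hV hxy hgen hx hx2
  -- `(p/q) = +1`: the single witness `φ_p`
  have hleg1 : jacobiSym p q = 1 :=
    (jacobiSym.eq_one_or_neg_one (by rw [Int.gcd_natCast_natCast]; exact (Nat.coprime_primes hp hq).mpr hpq)).resolve_right hleg
  have hqp : jacobiSym q p = 1 := by
    rw [jacobiSym.quadratic_reciprocity_one_mod_four' (hq.odd_of_ne_two hq2) (by omega : p % 4 = 1)]; exact hleg1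
  have h6 : n % 8 = 6 := by
    rw [hn, show 2 * r * p * q = (2 * r) * (p * q) by ring, Nat.mul_mod, Nat.mul_mod p q, hp8, hq8, Nat.mul_mod 2 r]; omega
  have hdvdn : ∀ {d : ℕ}, d ∈ n.divisors → d ∣ 2 * r * p * q := fun hd => hn ▸ Nat.dvd_of_mem_divisors hd
  have hmem : ∀ {d : ℕ}, d ∣ 2 * r * p * q → d ∈ n.divisors := fun hd => Nat.mem_divisors.mpr ⟨by rw [hn]; exact hd, hn0⟩
  have dp : p ∣ n := by rw [hn]; exact ⟨2 * r * q, by ring⟩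
  have v1 : jacobiSym (-1) p = 1 := jacobiSym_neg_one_eq_one hp (by omega)
  have hsym : ∀ p' : ℕ, p'.Prime → p' ∣ n → p' ≠ p → jacobiSym (-(p' : ℤ)) p = 1 := by
    intro p' hp' hp'n hne
    rcases TwoRPQFive.prime_dvd_two_rpq hr hp hq hp' (by rw [← hn]; exact hp'n) with rfl | rfl | rfl | rfl
    · rw [show (-((2 : ℕ) : ℤ)) = -2 by norm_num]; exact jacobiSym_neg_two_eq_one hp (by omega)
    · exact hrp
    · exact absurd rfl hne
    · rw [neg_eq_neg_one_mul, jacobiSym.mul_left, v1, one_mul]; exact hqp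
  obtain ⟨hLs, -, hrec, -, h35, -, -, -, h318, -, -⟩ := hPr
  obtain ⟨z, Φ, ΓH, ΓH', σ, θ, c, ρ₂, ρ₄, hc, hb⟩ := hV
  obtain ⟨φ, hF1, hF2, hFi, hFr, hF5⟩ := D.exists_frobenius_not_mem_of_clauses hsq hb hnn h6 hp dp hp2
  have heL : D.TrivialOnL n φ :=
    TwoRPQFive.trivialOnL_of_frobenius_display D hsq dvd_rfl hp dp v1 (fun p' hp' hp'd hne => hsym p' hp' hp'd hne) hF1 hFi hFr
  refine two_dvd_scriptL_of_coefficients_even_of_x_not_mem D hGZK hsq h6 hra hrec h35 hLs h318 z Φ ΓH ΓH' σ c hc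
    (fun d hd => ⟨(hb d hd).1, (hb d hd).2.2.1⟩) ⟨φ, heL, hF2, hF5⟩ (fun d hd hd6 hdn => ?_) (fun d hd hd5 => ?_) hxy hgen hx hx2
  · -- proper even blocks `2r`, `2rp`, `2rq`
    rcases (TwoRPQ.divisors_two_mul_three' hr hp hq hr4 hp8 hq8 (hdvdn hd)).2 hd6 with rfl | rfl | rfl | rfl
    · exact Or.inl ⟨r, hr, rfl⟩
    · refine Or.inr (Or.inr ?_)
      rw [show n / (2 * r * p) = q by rw [hn]; exact Nat.mul_div_cancel_left q (Nat.mul_pos (Nat.mul_pos two_pos hr.pos) hp.pos)]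
      exact even_scriptL_of_prime_one_mod_eight h11 D hLs hq hq8 (hmem ⟨2 * r * p, by ring⟩)
    · refine Or.inr (Or.inr ?_)
      rw [show n / (2 * r * q) = p by
        rw [hn, show 2 * r * p * q = (2 * r * q) * p by ring]; exact Nat.mul_div_cancel_left p (Nat.mul_pos (Nat.mul_pos two_pos hr.pos) hq.pos)]
      exact even_scriptL_of_prime_one_mod_eight h11 D hLs hp hp8 (hmem ⟨2 * r * q, by ring⟩)
    · exact absurd hn.symm hdn
  · exact absurd hd5 (TwoRPQ.divisors_two_mul_three' hr hp hq hr4 hp8 hq8 (hdvdn hd)).1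

/-- **THE LOWER HALF ON THE WHOLE CELL `n = 2rpq` FROM THE NAMED FACTS** (`OfFacts` shape, by-name closable; supersedes p737143's statement by dropping
`(p/q) = −1` and `p ≠ q`): `(tyz_cmPointRingClassFrobeniusValueData ∧ thm11_parity_of_scriptL ∧ GZK)` implies — for primes `r ≡ 3 (mod 4)`,
`p ≡ q ≡ 1 (mod 8)` with `(−r/p) = (−r/q) = 1`, `n = 2rpq` square-free, `ord_{s=1} L(E_n, s) = 1`, and a generator `R = (x, y)` of `E_n(ℚ)` modulo
torsion with `x ∉ {±1, ±2, ±n, ±2n}·ℚ^{×2}` — `2 ∣ L` whenever `𝓛(n)² = L²`.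
[cite: TianYuanZhang2017, Thm. 1.1, §1, §3, Prop. 3.2 (2)] [cite: Cox2013, §5.C Cor. 5.25, §9.A] [cite: HeathBrown1994SelmerCongruentII, §1] [cite: Darmon2004, Thm. 3.22] -/
theorem two_dvd_scriptL_two_rpq_all_of_facts :
    (tyz_cmPointRingClassFrobeniusValueData ∧ thm11_parity_of_scriptL ∧ rank_eq_analyticRank_of_analyticRank_le_one) →
      ∀ n r p q : ℕ, (hsq : Squarefree n) → r.Prime → p.Prime → q.Prime → n = 2 * r * p * q → r % 4 = 3 → p % 8 = 1 → q % 8 = 1 →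
        jacobiSym (-(r : ℤ)) p = 1 → jacobiSym (-(r : ℤ)) q = 1 →
        (haveI := isElliptic_congruentNumberCurve hsq.ne_zero; (congruentNumberCurve n).analyticRank = 1) →
        ∀ (x y : ℚ) (hxy : (congruentNumberCurve n).toAffine.Nonsingular x y),
          (haveI := isElliptic_congruentNumberCurve hsq.ne_zero;
            ∀ P, ∃ k : ℤ, IsOfFinAddOrder (P - k • (Point.some x y hxy : (congruentNumberCurve n).toAffine.Point))) →
          (¬ ∃ r : ℚ, x = r ^ 2 ∨ x = -r ^ 2 ∨ x = n * r ^ 2 ∨ x = -(n * r ^ 2)) →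
          (¬ ∃ r : ℚ, x = 2 * r ^ 2 ∨ x = -(2 * r ^ 2) ∨ x = 2 * n * r ^ 2 ∨ x = -(2 * n * r ^ 2)) →
            ∀ L : ℤ, IsScriptL n L → (2 : ℤ) ∣ L := by
  intro h n r p q hsq hr hp hq hn hr4 hp8 hq8 hrp hrq hra x y hxy hgen hx hx2
  have h6 : n % 8 = 6 := by
    rw [hn, show 2 * r * p * q = (2 * r) * (p * q) by ring, Nat.mul_mod, Nat.mul_mod p q, hp8, hq8, Nat.mul_mod 2 r]; omega
  obtain ⟨D, hPr, hV⟩ := h.1 n hsq (Or.inr (Or.inl h6))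
  exact two_dvd_scriptL_two_rpq_all_of_valuePrinted h.2.2 h.2.1 hsq hr hp hq hn hr4 hp8 hq8 hrp hrq hra D hPr hV hxy hgen hx hx2

end Summit.BirchSwinnertonDyer.PrintCf2.TwoRPQAll

end
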